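import Mathlib
import Summits.Ventures.HodgeRepro2.Tier7.Line3.KappaBound

/-!
# Tier 7 — LINE 3 support: the finite-place fields of `KappaData` at a SPLIT place (two conjugate absolute values)
(`Line3/KappaDataFinSplit.lean`; t7-L1-p5, gen 2; closes t7-crit-2's OBJECTION (E) on `KappaDataFin`, STATUS l. 15393)

`KappaDataFin` reads x1's bounds (`KappaBound` / `KappaCongruence`) at a finite place `w` of `K` through an absolute value
`abv` of `E` above `w` with `abv ∘ σ = abv` — which holds only when `w` is inert or ramified in `E / K`. When `w` SPLITS,
the two absolute values of `E` above `w` are exchanged by `σ`: `abv ∘ σ = abv′ ≠ abv`. This file redoes x1's three bounds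
with TWO absolute values `abv`, `abv′` and the single relation `hσ′ : ∀ x, abv (σ x) = abv′ x` (x1's case is `abv′ = abv`),
the entries now bounded at BOTH places:
* `abv_nrm_two`: `abv (N x) = abv x · abv′ x`; `abv_nrm_sub_nrm_le_two`: the ultrametric Lipschitz bound for the norm;
* `abv_kappa_le_two`: `abv (κ(γ)) ≤ M ^ 3 · M′ ^ 3 / abv (d₀ d′₀)` (entries `≤ M` for `abv`, `≤ M′` for `abv′`);
  `abv_kappa_sub_kappa_le_one_two` (integral at both places, unit discriminant product ⇒ `≤ 1`);
* `abv_kappa_mul_sub_kappa_le_two`: the congruence `κ(γ₀ k) − κ(γ₀)` with `k ≡ 1` to precision `ε` at `abv` and `ε′` at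
  `abv′`: `≤ M ^ 3 · M′ ^ 3 · max ε ε′ / abv (d₀ d′₀)`;
* the `KappaData` field forms `hout_field_split` / `hS_field_split` / `hcong_field_split` for the global invariant `κF`
  (`algebraMap K E (κF γ) = kappa σ d f (matO γ)`) at a place `w` of `K` with `hw : w x = abv (algebraMap K E x)`.
Together with `KappaDataFin` (non-split `w`) the finite fields of `KappaData` are supplied at EVERY finite place, from the
matrices on the support in the adapted coordinates. What stays in words: the support clauses (the dictionary
`K_v` / `K_N(v₁)` = integral / congruence matrices at the place(s) of `E` above `v`), as in `KappaDataFin`.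
Nothing about periods or (N). Pure algebra.
Sorry-free; axioms: propext / Classical.choice / Quot.sound. §8(d): uses an L-value-free non-vanishing device: NO.
-/

namespace Summit.Ventures.HodgeRepro2.Tier7.Line3.KappaDataFinSplit

open NumberField Matrix Summit.Ventures.HodgeRepro2.T7SupportTwoTorusInvariant
  Summit.Ventures.HodgeRepro2.Tier7.Line3.KappaBound Summit.Ventures.HodgeRepro2.Tier7.Line3.KappaCongruence

section general

variable {E : Type*} [Field E] (σ : E →+* E) (abv abv' : AbsoluteValue E ℝ)

/-- `abv (N x) = abv x · abv′ x` when `abv ∘ σ = abv′` -/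
theorem abv_nrm_two (hσ' : ∀ x, abv (σ x) = abv' x) (x : E) : abv (nrm σ x) = abv x * abv' x := by
  unfold nrm
  rw [abv.map_mul, hσ']

/-- the ultrametric Lipschitz bound for the norm with two conjugate absolute values -/
theorem abv_nrm_sub_nrm_le_two (hna : IsNonarchimedean abv) (hσ' : ∀ x, abv (σ x) = abv' x) (x y : E) :
    abv (nrm σ x - nrm σ y) ≤ max (abv (x - y) * abv' x) (abv y * abv' (x - y)) := by
  have h : nrm σ x - nrm σ y = (x - y) * σ x + y * σ (x - y) := by
    simp only [nrm, map_sub]; ring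
  rw [h]
  refine (hna _ _).trans ?_
  rw [abv.map_mul, abv.map_mul, hσ', hσ']

/-- **`|κ(γ)| ≤ M³ M′³ / |d₀ d′₀|`** with the entries of `γ`, `f 0`, `d 0` of size `≤ M` at `abv` and `≤ M′` at `abv′` -/
theorem abv_kappa_le_two (hna : IsNonarchimedean abv) (hna' : IsNonarchimedean abv')
    (hσ' : ∀ x, abv (σ x) = abv' x) (d : Fin 2 → E) (f : Fin 2 → Fin 2 → E) (γ : Matrix (Fin 2) (Fin 2) E)
    {M M' : ℝ} (hM : 0 ≤ M) (hM' : 0 ≤ M') (hγ : ∀ i j, abv (γ i j) ≤ M) (hf : ∀ i, abv (f 0 i) ≤ M)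
    (hd : abv (d 0) ≤ M) (hγ' : ∀ i j, abv' (γ i j) ≤ M') (hf' : ∀ i, abv' (f 0 i) ≤ M')
    (hd' : abv' (d 0) ≤ M') :
    abv (kappa σ d f γ) ≤ M ^ 3 * M' ^ 3 / abv (d 0 * disc' σ d f 0) := by
  have hc : abv (cc d f γ 0 0) ≤ M ^ 3 := abv_cc_le abv hna d f γ hM hγ hf hd
  have hc' : abv' (cc d f γ 0 0) ≤ M' ^ 3 := abv_cc_le abv' hna' d f γ hM' hγ' hf' hd'
  have hn : abv (nrm σ (cc d f γ 0 0)) ≤ M ^ 3 * M' ^ 3 := by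
    rw [abv_nrm_two σ abv abv' hσ']
    exact mul_le_mul hc hc' (abv'.nonneg _) (by positivity)
  rw [kappa, map_div₀ abv]
  by_cases hden : abv (d 0 * disc' σ d f 0) = 0
  · rw [hden, div_zero, div_zero]
  · have hpos : 0 < abv (d 0 * disc' σ d f 0) := lt_of_le_of_ne (abv.nonneg _) (Ne.symm hden)
    exact div_le_div_of_nonneg_right hn hpos.le

/-- the integral case at both places: `|κ(γ)| ≤ 1` -/
theorem abv_kappa_le_one_two (hna : IsNonarchimedean abv) (hna' : IsNonarchimedean abv')
    (hσ' : ∀ x, abv (σ x) = abv' x) (d : Fin 2 → E) (f : Fin 2 → Fin 2 → E) (γ : Matrix (Fin 2) (Fin 2) E)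
    (hγ : ∀ i j, abv (γ i j) ≤ 1) (hf : ∀ i, abv (f 0 i) ≤ 1) (hd : abv (d 0) ≤ 1)
    (hγ' : ∀ i j, abv' (γ i j) ≤ 1) (hf' : ∀ i, abv' (f 0 i) ≤ 1) (hd' : abv' (d 0) ≤ 1)
    (hdisc : abv (d 0 * disc' σ d f 0) = 1) :
    abv (kappa σ d f γ) ≤ 1 := by
  have h := abv_kappa_le_two σ abv abv' hna hna' hσ' d f γ zero_le_one zero_le_one hγ hf hd hγ' hf' hd'
  simpa [hdisc] using h

/-- **`hout` at a split place**: two isometries integral at both places ⇒ `|κ(γ) − κ(γ₀)| ≤ 1` -/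
theorem abv_kappa_sub_kappa_le_one_two (hna : IsNonarchimedean abv) (hna' : IsNonarchimedean abv')
    (hσ' : ∀ x, abv (σ x) = abv' x) (d : Fin 2 → E) (f : Fin 2 → Fin 2 → E)
    (γ γ₀ : Matrix (Fin 2) (Fin 2) E) (hγ : ∀ i j, abv (γ i j) ≤ 1) (hγ₀ : ∀ i j, abv (γ₀ i j) ≤ 1)
    (hf : ∀ i, abv (f 0 i) ≤ 1) (hd : abv (d 0) ≤ 1) (hγ' : ∀ i j, abv' (γ i j) ≤ 1)
    (hγ₀' : ∀ i j, abv' (γ₀ i j) ≤ 1) (hf' : ∀ i, abv' (f 0 i) ≤ 1) (hd' : abv' (d 0) ≤ 1)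
    (hdisc : abv (d 0 * disc' σ d f 0) = 1) :
    abv (kappa σ d f γ - kappa σ d f γ₀) ≤ 1 := by
  have h1 := abv_kappa_le_one_two σ abv abv' hna hna' hσ' d f γ hγ hf hd hγ' hf' hd' hdisc
  have h2 := abv_kappa_le_one_two σ abv abv' hna hna' hσ' d f γ₀ hγ₀ hf hd hγ₀' hf' hd' hdisc
  have h := hna (kappa σ d f γ) (-(kappa σ d f γ₀))
  rw [← sub_eq_add_neg, abv.map_neg] at h
  exact h.trans (max_le h1 h2)

/-- **the local congruence at a split place**: `k ≡ 1` to precision `ε` at `abv` and `ε′` at `abv′`, entries of `γ₀`,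
`f 0`, `d 0` of size `≤ M` / `≤ M′` (`M, M′ ≥ 1`, `ε′ ≤ 1`):
`abv (κ(γ₀ k) − κ(γ₀)) ≤ M³ M′³ max ε ε′ / abv (d₀ d′₀)` -/
theorem abv_kappa_mul_sub_kappa_le_two (hna : IsNonarchimedean abv) (hna' : IsNonarchimedean abv')
    (hσ' : ∀ x, abv (σ x) = abv' x) (d : Fin 2 → E) (f : Fin 2 → Fin 2 → E)
    (γ₀ k : Matrix (Fin 2) (Fin 2) E) {ε ε' M M' : ℝ} (hε : 0 ≤ ε) (hε' : 0 ≤ ε')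
    (hε1' : ε' ≤ 1) (hM : 1 ≤ M) (hM' : 1 ≤ M')
    (hk : ∀ i j, abv ((k - 1) i j) ≤ ε) (hγ : ∀ i j, abv (γ₀ i j) ≤ M) (hf : ∀ i, abv (f 0 i) ≤ M)
    (hd : abv (d 0) ≤ M) (hk' : ∀ i j, abv' ((k - 1) i j) ≤ ε') (hγ' : ∀ i j, abv' (γ₀ i j) ≤ M')
    (hf' : ∀ i, abv' (f 0 i) ≤ M') (hd' : abv' (d 0) ≤ M') :
    abv (kappa σ d f (γ₀ * k) - kappa σ d f γ₀) ≤
      M ^ 3 * M' ^ 3 * max ε ε' / abv (d 0 * disc' σ d f 0) := by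
  have hM0 : 0 ≤ M := zero_le_one.trans hM
  have hM0' : 0 ≤ M' := zero_le_one.trans hM'
  set c := cc d f (γ₀ * k) 0 0 with hc
  set c₀ := cc d f γ₀ 0 0 with hc₀
  have hdiff : abv (c - c₀) ≤ M ^ 3 * ε := abv_cc_mul_sub_cc_le abv hna d f γ₀ k hε hM0 hk hγ hf hd
  have hdiff' : abv' (c - c₀) ≤ M' ^ 3 * ε' := abv_cc_mul_sub_cc_le abv' hna' d f γ₀ k hε' hM0' hk' hγ' hf' hd'
  have hc₀le : abv c₀ ≤ M ^ 3 := abv_cc_le abv hna d f γ₀ hM0 hγ hf hd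
  have hc₀le' : abv' c₀ ≤ M' ^ 3 := abv_cc_le abv' hna' d f γ₀ hM0' hγ' hf' hd'
  have hcle' : abv' c ≤ M' ^ 3 := by
    have : c = (c - c₀) + c₀ := by ring
    rw [this]
    refine (hna' _ _).trans (max_le ?_ hc₀le')
    refine hdiff'.trans ?_
    have : M' ^ 3 * ε' ≤ M' ^ 3 * 1 := mul_le_mul_of_nonneg_left hε1' (by positivity)
    linarith
  have hmax0 : 0 ≤ max ε ε' := le_max_of_le_left hε
  have hnrm : abv (nrm σ c - nrm σ c₀) ≤ M ^ 3 * M' ^ 3 * max ε ε' := by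
    refine (abv_nrm_sub_nrm_le_two σ abv abv' hna hσ' c c₀).trans (max_le ?_ ?_)
    · calc abv (c - c₀) * abv' c ≤ (M ^ 3 * ε) * M' ^ 3 :=
            mul_le_mul hdiff hcle' (abv'.nonneg _) (by positivity)
        _ = M ^ 3 * M' ^ 3 * ε := by ring
        _ ≤ M ^ 3 * M' ^ 3 * max ε ε' :=
            mul_le_mul_of_nonneg_left (le_max_left _ _) (by positivity)
    · calc abv c₀ * abv' (c - c₀) ≤ M ^ 3 * (M' ^ 3 * ε') :=
            mul_le_mul hc₀le hdiff' (abv'.nonneg _) (by positivity)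
        _ = M ^ 3 * M' ^ 3 * ε' := by ring
        _ ≤ M ^ 3 * M' ^ 3 * max ε ε' :=
            mul_le_mul_of_nonneg_left (le_max_right _ _) (by positivity)
  have hκ : kappa σ d f (γ₀ * k) - kappa σ d f γ₀ = (nrm σ c - nrm σ c₀) / (d 0 * disc' σ d f 0) := by
    simp only [kappa, hc, hc₀]
    rw [sub_div]
  rw [hκ, map_div₀ abv]
  by_cases hden : abv (d 0 * disc' σ d f 0) = 0
  · rw [hden, div_zero, div_zero]
  · have hpos : 0 < abv (d 0 * disc' σ d f 0) := lt_of_le_of_ne (abv.nonneg _) (Ne.symm hden)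
    exact div_le_div_of_nonneg_right hnrm hpos.le

end general

/-! ## The `KappaData` field forms at a split place -/

section fields

variable {E K : Type*} [Field E] [Field K] [NumberField K] [Algebra K E] (σ : E →+* E)
  (abv abv' : AbsoluteValue E ℝ) (d : Fin 2 → E) (f : Fin 2 → Fin 2 → E) {Orb : Type*}
  (matO : Orb → Matrix (Fin 2) (Fin 2) E) (κF : Orb → K) (w : FinitePlace K) (arith : ℕ → Orb → Prop) (γ₀ : Orb)

/-- the place of `K` applied to a difference of global invariants -/
theorem place_sub_eq_abv (hw : ∀ x : K, w x = abv (algebraMap K E x))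
    (hκ : ∀ γ, algebraMap K E (κF γ) = kappa σ d f (matO γ)) (γ γ₀ : Orb) :
    w (κF γ - κF γ₀) = abv (kappa σ d f (matO γ) - kappa σ d f (matO γ₀)) := by
  rw [hw, map_sub, hκ, hκ]

/-- **`hout` at a split place**: integrality of the matrices on the support at both places above `w` -/
theorem hout_field_split (hw : ∀ x : K, w x = abv (algebraMap K E x))
    (hκ : ∀ γ, algebraMap K E (κF γ) = kappa σ d f (matO γ)) (hna : IsNonarchimedean abv)
    (hna' : IsNonarchimedean abv') (hσ' : ∀ x, abv (σ x) = abv' x)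
    (hf : ∀ i, abv (f 0 i) ≤ 1) (hd : abv (d 0) ≤ 1) (hf' : ∀ i, abv' (f 0 i) ≤ 1) (hd' : abv' (d 0) ≤ 1)
    (hdisc : abv (d 0 * disc' σ d f 0) = 1) (hγ₀ : ∀ i j, abv (matO γ₀ i j) ≤ 1)
    (hγ₀' : ∀ i j, abv' (matO γ₀ i j) ≤ 1)
    (hsupp : ∀ N γ, arith N γ → (∀ i j, abv (matO γ i j) ≤ 1) ∧ ∀ i j, abv' (matO γ i j) ≤ 1) :
    ∀ N γ, arith N γ → w (κF γ - κF γ₀) ≤ 1 := by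
  intro N γ hγ
  rw [place_sub_eq_abv σ abv d f matO κF w hw hκ]
  exact abv_kappa_sub_kappa_le_one_two σ abv abv' hna hna' hσ' d f (matO γ) (matO γ₀) (hsupp N γ hγ).1 hγ₀
    hf hd (hsupp N γ hγ).2 hγ₀' hf' hd' hdisc

/-- **`hS` at a split place**: uniform bounds `M` / `M′` on the entries at the two places above `w` -/
theorem hS_field_split (hw : ∀ x : K, w x = abv (algebraMap K E x))
    (hκ : ∀ γ, algebraMap K E (κF γ) = kappa σ d f (matO γ)) (hna : IsNonarchimedean abv)
    (hna' : IsNonarchimedean abv') (hσ' : ∀ x, abv (σ x) = abv' x) {M M' : ℝ} (hM : 0 ≤ M) (hM' : 0 ≤ M')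
    (hf : ∀ i, abv (f 0 i) ≤ M) (hd : abv (d 0) ≤ M) (hf' : ∀ i, abv' (f 0 i) ≤ M') (hd' : abv' (d 0) ≤ M')
    (hγ₀ : ∀ i j, abv (matO γ₀ i j) ≤ M) (hγ₀' : ∀ i j, abv' (matO γ₀ i j) ≤ M')
    (hsupp : ∀ N γ, arith N γ → (∀ i j, abv (matO γ i j) ≤ M) ∧ ∀ i j, abv' (matO γ i j) ≤ M') :
    ∀ N γ, arith N γ → w (κF γ - κF γ₀) ≤ M ^ 3 * M' ^ 3 / abv (d 0 * disc' σ d f 0) := by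
  intro N γ hγ
  rw [place_sub_eq_abv σ abv d f matO κF w hw hκ]
  have h1 := abv_kappa_le_two σ abv abv' hna hna' hσ' d f (matO γ) hM hM' (hsupp N γ hγ).1 hf hd
    (hsupp N γ hγ).2 hf' hd'
  have h2 := abv_kappa_le_two σ abv abv' hna hna' hσ' d f (matO γ₀) hM hM' hγ₀ hf hd hγ₀' hf' hd'
  have h := hna (kappa σ d f (matO γ)) (-(kappa σ d f (matO γ₀)))
  rw [← sub_eq_add_neg, abv.map_neg] at h
  exact h.trans (max_le h1 h2)

/-- **`hcong` at a split place**: the level-`N` congruence `matO γ = matO γ₀ · k`, `k ≡ 1 mod q⁻¹ ^ N` at BOTH places -/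
theorem hcong_field_split (hw : ∀ x : K, w x = abv (algebraMap K E x))
    (hκ : ∀ γ, algebraMap K E (κF γ) = kappa σ d f (matO γ)) (hna : IsNonarchimedean abv)
    (hna' : IsNonarchimedean abv') (hσ' : ∀ x, abv (σ x) = abv' x)
    (hf : ∀ i, abv (f 0 i) ≤ 1) (hd : abv (d 0) ≤ 1) (hf' : ∀ i, abv' (f 0 i) ≤ 1) (hd' : abv' (d 0) ≤ 1)
    (hdisc : abv (d 0 * disc' σ d f 0) = 1) {q : ℝ} (hq : 1 < q) (hγ₀ : ∀ i j, abv (matO γ₀ i j) ≤ 1)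
    (hγ₀' : ∀ i j, abv' (matO γ₀ i j) ≤ 1)
    (hsupp : ∀ N γ, arith N γ → ∃ k : Matrix (Fin 2) (Fin 2) E, matO γ = matO γ₀ * k ∧
      (∀ i j, abv ((k - 1) i j) ≤ q⁻¹ ^ N) ∧ ∀ i j, abv' ((k - 1) i j) ≤ q⁻¹ ^ N) :
    ∀ N γ, arith N γ → w (κF γ - κF γ₀) ≤ q⁻¹ ^ N := by
  intro N γ hγ
  obtain ⟨k, hγk, hk, hk'⟩ := hsupp N γ hγ
  rw [place_sub_eq_abv σ abv d f matO κF w hw hκ, hγk]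
  have hq0 : 0 < q := zero_lt_one.trans hq
  have hε : 0 ≤ q⁻¹ ^ N := by positivity
  have hε1 : q⁻¹ ^ N ≤ 1 := pow_le_one₀ (by positivity) (inv_le_one_of_one_le₀ hq.le)
  have h := abv_kappa_mul_sub_kappa_le_two σ abv abv' hna hna' hσ' d f (matO γ₀) k hε hε hε1 le_rfl
    le_rfl hk hγ₀ hf hd hk' hγ₀' hf' hd'
  simpa [hdisc] using h

end fields

end Summit.Ventures.HodgeRepro2.Tier7.Line3.KappaDataFinSplit
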